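import Summits.HodgeConjecture.HodgeConjecture.Theorems.R90S6HeckeCoeffIndepInertTwo     -- ★ W9-A.5 `coeff_toVector_comp_eq_of_memLaw_inert_two`
import Mathlib.NumberTheory.NumberField.CMField

/-!
# R90 · S6 (Rogawski Ch. 14.1–5, stable trace formula) — W9-A.6: «eG-independence» THE SOCKET DRESS at `N = 2` — CM field `L`, `c = complexConj L`,
# `≃ₜ*` transports with the K-law in the token shape of D :304–:308 (`eH`) (`Theorems/R90S6HeckeCoeffIndepCMTwo.lean`)

Helper for the S6 floor socket `R90.S6.StubR90ExtE1HeckeFL` (`Cruxes/H413/Lines/R90_S6_FloorE1D.lean` :304–:308: the `eH`-binder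
`eH : (cmDatum L 2 Φ₂).Local v ≃ₜ* U(σ_w, antidiag(1,1))(L_w)` with K-law `eH h ∈ unitaryInt … ↔ h ∈ cmLocalIntegralLevel L 2 Φ₂ v`, read as
`fun h => heckeToFun K₀ φH (eH h.1)`), DAG r5 row E1.3.9.1; the `N = 2` twin of the W9-A sheet target (A.3) `coeff_toVector_comp_eq_of_memLaw_cm`
(`R90/R90-C14-typ1/g2/S6_wave9A_targets.v1.db09522d8f01f282.lean` :168, binders `3 ↦ 2`; the carrier `Gv` stays GENERIC so D's `(cmDatum L 2 Φ₂).Local v`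
instantiates, `heckeToFun K₀ f (eH g) = (toVector K₀ f).coeff ((eH g : U) : U ⧸ K₀)` by `rfl` at the junction).  PROOF = ★ (A.5) `coeff_toVector_comp_eq_of_memLaw_inert_two`
at `F := ↥(maximalRealSubfield L)`, `E := L`, `c := IsCMField.complexConj L`, `hc :=` ★ `IsCMField.complexConj_ne_one L`, `haveI := IsCMField.isQuadraticExtension L`,
`e := eG.toMulEquiv`, `e' := eG'.toMulEquiv` (continuity forgotten).

Cell `hodgecm-mathlib`, crux H413 (`stmt-HodgeConjecture-24833`), route of record `HCCMUnconditional`; programme R90-TF (brief `director/R90-BRIEF.v2.md`),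
section S6 (base `R90-C14`), seat R90-C14-p02 (g2) (S6 dealer R90-C14-plan (g2) 2026-09-04T23:58:41Z «(A.5)∕(A.6) N = 2 twins»).  Lane
`--supports stmt-HodgeConjecture-24833 --as helper`; ONE theorem, no definition, no `sorry`, no instance, no notation; imports ★ Theorems + Mathlib only (never Lines).
HONEST LABEL: a helper theorem, count-neutral until the E1.3.9 assembly consumes it; HC_CM is proved only modulo the 7 printed citations (2 remaining named inputs:
hLiu418 = stmt-HodgeConjecture-24832, h413 = stmt-HodgeConjecture-24833) until rung 0 closes.

## References
* [CartierCorvallis1979] P. Cartier, *Representations of p-adic groups: a survey*, Proc. Sympos. Pure Math. 33 (1979), Part 1, §IV.1.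
* [Rogawski1990] J. D. Rogawski, *Automorphic Representations of Unitary Groups in Three Variables*, Ann. of Math. Stud. 123 (1990), §4.9 p. 55 (the `H`-side
  `U(2) × U(1)` of Prop. 4.9.1 (b)); §4.10 Prop. 4.10.1.
-/

set_option autoImplicit false
-- the mandated namespace repeats the single-problem summit's segment (`HodgeConjecture.HodgeConjecture`)
set_option linter.dupNamespace false

noncomputable section

open scoped Valued WithZero Matrix MatrixGroups

open MulAction MonoidAlgebra
open Literature.NumberTheory.Automorphic Literature.NumberTheory.Automorphic.HermitianLattice

namespace Summit.HodgeConjecture.HodgeConjecture.R90.S6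

section CM

open _root_.NumberField _root_.IsDedekindDomain Literature.NumberTheory.Automorphic.UnitaryGroup

/-- **W9-A.6 «eG-INDEPENDENCE», SOCKET DRESS, `N = 2`** (the `eH`-binder of `StubR90ExtE1HeckeFL`): at an inert (`hw`) unramified (`hv`) place `w ∣ v` of the CM
field `L`, any two topological-group isomorphisms `eG eG' : Gv ≃ₜ* U(σ_w, antidiag(1,1))(L_w)` with the K-law `eG g ∈ K₀ ↔ g ∈ Kv` read every `f ∈ ℋ(U_w, K₀)`
(over `ℂ`) as the same function `g ↦ (f [K₀])((eG g) K₀)` (= D's `heckeToFun K₀ f (eG g)` by `rfl`).  Route: ★ (A.5) `coeff_toVector_comp_eq_of_memLaw_inert_two` at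
`F := ↥(maximalRealSubfield L)`, `c := IsCMField.complexConj L` (`≠ 1`: ★ `IsCMField.complexConj_ne_one`), `e := eG.toMulEquiv`, `e' := eG'.toMulEquiv`.  The `N = 2` twin
of W9-A (A.3). [folklore; cite: CartierCorvallis1979, §IV.1] [cite: Rogawski1990, §4.9 p. 55; §4.10 Prop. 4.10.1] -/
theorem coeff_toVector_comp_eq_of_memLaw_cm_two (L : Type) [Field L] [NumberField L] [IsCMField L]
    {v : HeightOneSpectrum (𝓞 ↥(maximalRealSubfield L))} (w : UnitaryGroup.PlacesOver L v) (hw : IsCMField.complexConj L • w.1 = w.1)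
    (hv : Algebra.IsUnramifiedIn (𝓞 L) v.asIdeal)
    {Gv : Type*} [Group Gv] [TopologicalSpace Gv] (Kv : Subgroup Gv)
    (eG eG' : Gv ≃ₜ* ↥(unitaryGroupOfForm (galAdicCompletionMap (L := L) (IsCMField.complexConj L) hw) ((StdForm.antidiagonal 2).over (w.1.adicCompletion L))))
    (heG : ∀ g : Gv,
      eG g ∈ unitaryInt (galAdicCompletionMap (L := L) (IsCMField.complexConj L) hw) ((StdForm.antidiagonal 2).over (w.1.adicCompletion L)) ↔ g ∈ Kv)
    (heG' : ∀ g : Gv,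
      eG' g ∈ unitaryInt (galAdicCompletionMap (L := L) (IsCMField.complexConj L) hw) ((StdForm.antidiagonal 2).over (w.1.adicCompletion L)) ↔ g ∈ Kv)
    (f : heckeAlgebra ℂ ↥(unitaryGroupOfForm (galAdicCompletionMap (L := L) (IsCMField.complexConj L) hw) ((StdForm.antidiagonal 2).over (w.1.adicCompletion L)))
      (unitaryInt (galAdicCompletionMap (L := L) (IsCMField.complexConj L) hw) ((StdForm.antidiagonal 2).over (w.1.adicCompletion L)))) :
    (fun g : Gv => (heckeAlgebra.toVector (unitaryInt (galAdicCompletionMap (L := L) (IsCMField.complexConj L) hw) ((StdForm.antidiagonal 2).over (w.1.adicCompletion L))) f).coeff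
        ((eG' g : ↥(unitaryGroupOfForm (galAdicCompletionMap (L := L) (IsCMField.complexConj L) hw) ((StdForm.antidiagonal 2).over (w.1.adicCompletion L)))) :
          ↥(unitaryGroupOfForm (galAdicCompletionMap (L := L) (IsCMField.complexConj L) hw) ((StdForm.antidiagonal 2).over (w.1.adicCompletion L))) ⧸
            unitaryInt (galAdicCompletionMap (L := L) (IsCMField.complexConj L) hw) ((StdForm.antidiagonal 2).over (w.1.adicCompletion L)))) =
      fun g : Gv => (heckeAlgebra.toVector (unitaryInt (galAdicCompletionMap (L := L) (IsCMField.complexConj L) hw) ((StdForm.antidiagonal 2).over (w.1.adicCompletion L))) f).coeff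
        ((eG g : ↥(unitaryGroupOfForm (galAdicCompletionMap (L := L) (IsCMField.complexConj L) hw) ((StdForm.antidiagonal 2).over (w.1.adicCompletion L)))) :
          ↥(unitaryGroupOfForm (galAdicCompletionMap (L := L) (IsCMField.complexConj L) hw) ((StdForm.antidiagonal 2).over (w.1.adicCompletion L))) ⧸
            unitaryInt (galAdicCompletionMap (L := L) (IsCMField.complexConj L) hw) ((StdForm.antidiagonal 2).over (w.1.adicCompletion L))) := by
  haveI : Algebra.IsQuadraticExtension ↥(maximalRealSubfield L) L := IsCMField.isQuadraticExtension L
  exact coeff_toVector_comp_eq_of_memLaw_inert_two (IsCMField.complexConj L) v (IsCMField.complexConj_ne_one L) hv w hw Kv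
    eG.toMulEquiv eG'.toMulEquiv heG heG' f

end CM

end Summit.HodgeConjecture.HodgeConjecture.R90.S6

end
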